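import Literature.Geometry.Lorentzian.ConformalScalarFlat
import Literature.Geometry.Lorentzian.ConformalChange
import Literature.Geometry.Lorentzian.CurvatureRegularity
import Literature.Geometry.Lorentzian.VolumePositivity
import HarnessLib

/-!
# Schoen–Yau 1979, Cor. 3.1: the sign of the mass from the formula (3.16)

`ConformalScalarFlat.lean` decomposes Schoen–Yau's Corollary 3.1 (Comm. Math. Phys. 65 (1979),
p. 72; the named fact `exists_conformal_negativeMass_of_massZero` of `PositiveMassRigidity.lean`)
into the elliptic core (the conformal factor `φ > 0`, `Δφ = Rφ/8`, `φ = 1 + A/r + O₂(r⁻²)`), the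
conformal scalar-curvature formula, and the proved mass read-off `M' = 2A`
(`IsAsymptoticallySchwarzschild.conformal`), asking of the elliptic core the *sign* `A < 0` of the
mass term. In print that sign is not part of the elliptic theory: Lemma 3.2 gives the coefficient
by the formula (3.16), `A = -(1/4π) ∫_N (fv + h) √g dx`, which for the equation (3.23) of
Lemma 3.3 (`f = h = R/8`, `φ = 1 + v`) reads `A = -(1/32π) ∫_N R φ √g dx` (so that `φ⁴ ds²` has
total mass `2A = -(1/16π) ∫_N R φ √g dx`, the formula printed in Lemma 3.3), and Cor. 3.1 infers
"negative total mass" from `R ≥ 0`, `R ≢ 0`, `φ > 0`. This file proves that inference and the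
corresponding forms of the reduction:

* `integral_scalarCurvature_mul_pos` — **the sign**: if `R ≥ 0` does not vanish identically and
  `φ > 0`, then `∫_X R φ dV_h > 0` (granted integrability): `R` is continuous
  (`PseudoRiemannianMetric.contMDiff_scalarCurvature`), so `{R ≠ 0}` is a nonempty open set, and
  the Riemannian measure `dV_h = riemannianMeasure D.h` charges nonempty open sets
  (`isOpenPosMeasure_riemannianMeasure`, `VolumePositivity.lean`);
* `exists_conformal_negativeMass_of_massZero_of_conformalFactor_integral` — Cor. 3.1 from the
  conformal scalar-curvature formula and the elliptic core **with the printed formula (3.16) for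
  `A` in place of its sign** (and for all data with `R ≥ 0`, the hypothesis `R ≢ 0` of Cor. 3.1
  being consumed by the sign only), through
  `exists_conformal_negativeMass_of_conformalFactor` of `ConformalScalarFlat.lean`;
* `exists_conformal_negativeMass_of_massZero_of_lemma33` — Cor. 3.1 from the conclusion of
  **Lemma 3.3 as printed** (pp. 71–72) in the case `R ≥ 0`: a positive `φ` such that `φ⁴ ds²` is
  scalar flat and asymptotically flat of total mass `-(1/16π) ∫_N R φ √g dx` (this form does not
  go through the transformation law, scalar flatness being part of the printed conclusion).
* `exists_conformal_negativeMass_of_massZero_of_ellipticCore` — Cor. 3.1 from the **elliptic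
  core alone** (the conformal factor of Lemmas 3.2–3.3 with the formula (3.16)): the conformal
  scalar-curvature formula `R(φ⁴h) = φ⁻⁵(Rφ − 8Δφ)` (p. 49), an explicit hypothesis of the two
  reductions above, is now the theorem `conformal_scalarCurvature_law` (`ConformalChange.lean`)
  and is discharged here (`D.h` is Riemannian, `InitialDataSet.isRiemannian_metric`); likewise
  `scalarFlat_of_massZero_of_ellipticCore` for step 1 of the rigidity theorem.

## Design

* The hypotheses quantify over the data exactly like the facts of `PositiveMassRigidity.lean`,
  plus the instance hypotheses `[LocallyCompactSpace X] [MeasurableSpace X] [BorelSpace X]` under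
  which `riemannianMeasure D.h` (`Volume.lean`) is available, as in `MassCapacity.lean`; the
  reductions supply them (`Manifold.locallyCompact_of_finiteDimensional`, `borel X`).
* `∫_N R φ √g dx` is the Bochner integral of `R φ` against `riemannianMeasure D.h`; the
  integrability of `R φ` is part of the hypotheses (in print a convergent integral: `R = O(r⁻⁴)`,
  `φ → 1`).

## References

* R. Schoen, S.-T. Yau, *On the proof of the positive mass conjecture in general relativity*,
  Comm. Math. Phys. 65 (1979) 45–76: Lemma 3.2 (p. 64) with (3.16) (p. 68), Lemma 3.3
  (pp. 71–72) with (3.22)–(3.23), Cor. 3.1 (p. 72).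
-/

noncomputable section

open Bundle Set Manifold TopologicalSpace Filter Asymptotics Module MeasureTheory Bornology
open scoped ContDiff Topology Manifold ENNReal

namespace Literature.Geometry.Lorentzian

/-! ### The sign of `∫ R φ dV` -/

/-- **The sign in Corollary 3.1**: if `R ≥ 0` does not vanish identically and `φ > 0`, then
`∫_X R φ dV_h > 0` (granted integrability) — `R` is continuous
(`PseudoRiemannianMetric.contMDiff_scalarCurvature`), so `{R ≠ 0}` is a nonempty open set, of
positive Riemannian measure (`isOpenPosMeasure_riemannianMeasure`). Schoen–Yau 1979, Cor. 3.1
(p. 72: "negative total mass", the mass being `-(1/16π) ∫_N R φ √g dx` by Lemma 3.3 and (3.16)).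
[cite: SchoenYauPMT1979, Cor. 3.1 (p. 72)] -/
theorem integral_scalarCurvature_mul_pos {X : Type} [TopologicalSpace X] [ChartedSpace E3 X]
    [IsManifold (𝓡 3) ∞ X] [T2Space X] [LocallyCompactSpace X] [MeasurableSpace X]
    [BorelSpace X] (D : InitialDataSet (𝓡 3) X) [D.metric.HasLeviCivita] {φ : X → ℝ}
    (hR : ∀ x : X, 0 ≤ D.metric.scalarCurvature x) (hne : ∃ x : X, D.metric.scalarCurvature x ≠ 0)
    (hφ : ∀ x : X, 0 < φ x)
    (hint : Integrable (fun x ↦ D.metric.scalarCurvature x * φ x) (riemannianMeasure D.h)) :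
    0 < ∫ x, D.metric.scalarCurvature x * φ x ∂(riemannianMeasure D.h) := by
  haveI := isOpenPosMeasure_riemannianMeasure (I := 𝓡 3) D.h
  rw [integral_pos_iff_support_of_nonneg (fun x ↦ mul_nonneg (hR x) (hφ x).le) hint]
  have hsupp : Function.support (fun x ↦ D.metric.scalarCurvature x * φ x) =
      {x | D.metric.scalarCurvature x ≠ 0} := by
    ext x
    simp [(hφ x).ne']
  rw [hsupp]
  exact (isOpen_ne_fun D.metric.contMDiff_scalarCurvature.continuous continuous_const).measure_pos
    _ hne

/-- **The mass term of the conformal factor is negative**: if `R ≥ 0`, `R ≢ 0`, `φ > 0`, `R φ`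
is integrable and `A = -(1/32π) ∫_X R φ dV_h` (Schoen–Yau 1979, (3.16) for the equation (3.23):
`A = -(1/4π) ∫_N (fv + h) √g dx` with `f = h = R/8`, `v = φ - 1`), then `A < 0`.
[cite: SchoenYauPMT1979, Lemma 3.2 (3.16) and Cor. 3.1 (p. 72)] -/
theorem conformalFactor_coeff_neg {X : Type} [TopologicalSpace X] [ChartedSpace E3 X]
    [IsManifold (𝓡 3) ∞ X] [T2Space X] [LocallyCompactSpace X] [MeasurableSpace X]
    [BorelSpace X] (D : InitialDataSet (𝓡 3) X) [D.metric.HasLeviCivita] {φ : X → ℝ} {A : ℝ}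
    (hR : ∀ x : X, 0 ≤ D.metric.scalarCurvature x) (hne : ∃ x : X, D.metric.scalarCurvature x ≠ 0)
    (hφ : ∀ x : X, 0 < φ x)
    (hint : Integrable (fun x ↦ D.metric.scalarCurvature x * φ x) (riemannianMeasure D.h))
    (hA : A = -(32 * Real.pi)⁻¹ * ∫ x, D.metric.scalarCurvature x * φ x ∂(riemannianMeasure D.h)) :
    A < 0 := by
  have hI := integral_scalarCurvature_mul_pos D hR hne hφ hint
  have h32 : 0 < (32 * Real.pi)⁻¹ := by positivity
  rw [hA]
  nlinarith

/-! ### Cor. 3.1 from the elliptic core with the formula (3.16) -/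

/-- **Cor. 3.1 from the remaining printed steps, with the formula (3.16) for the mass term.** As
`exists_conformal_negativeMass_of_massZero_of_conformalFactor` (`ConformalScalarFlat.lean`), the
named fact `exists_conformal_negativeMass_of_massZero` (Schoen–Yau 1979, Cor. 3.1, p. 72) follows
from the conformal scalar-curvature formula in dimension three (`hR`, p. 49: `R̃ = φ⁻⁵(-8Δφ + Rφ)`)
and the elliptic core of Lemmas 3.2–3.3 (`hφ`) — here for all admissible `(X, h, e)` with `R ≥ 0`
(`X` oriented, `h - δ = o₅(r⁻²)`, one end; Borel and locally compact instances included so that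
the Riemannian measure is available) and with, in place of the sign of `A`, the printed formula:
a smooth `φ > 0` with `Δ_h φ = R φ / 8` ((3.22)), `R φ` integrable,
`A = -(1/32π) ∫_X R φ dV_h` ((3.16) for (3.23)) and `φ = 1 + A/r + O₂(r⁻²)` in the chart of
`e` ((3.17)–(3.18), (3.20)). The sign `A < 0` under the extra hypothesis `R ≢ 0` of Cor. 3.1 is
`conformalFactor_coeff_neg`. [cite: SchoenYauPMT1979, Cor. 3.1 (p. 72) with Lemma 3.2 (3.16) and Lemma 3.3] -/
theorem exists_conformal_negativeMass_of_massZero_of_conformalFactor_integral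
    (hR : ∀ (X : Type) [TopologicalSpace X] [ChartedSpace E3 X] [IsManifold (𝓡 3) ∞ X]
      (D : InitialDataSet (𝓡 3) X) [D.metric.HasLeviCivita] (φ : X → ℝ)
      (hφ : ContMDiff (𝓡 3) 𝓘(ℝ) ∞ φ) (hpos : ∀ x, 0 < φ x)
      [(D.conformal φ hφ hpos).metric.HasLeviCivita] (x : X),
      (D.conformal φ hφ hpos).metric.scalarCurvature x =
        (φ x)⁻¹ ^ 5 * (D.metric.scalarCurvature x * φ x - 8 * D.metric.dalembertian φ x))
    (hφ : ∀ (X : Type) [TopologicalSpace X] [ChartedSpace E3 X] [IsManifold (𝓡 3) ∞ X]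
      [T2Space X] [SecondCountableTopology X] [LocallyCompactSpace X] [ConnectedSpace X]
      [MeasurableSpace X] [BorelSpace X]
      (D : InitialDataSet (𝓡 3) X) [D.metric.HasLeviCivita] (e : AFEnd X),
      Literature.Topology.FourManifolds.IsOrientable (𝓡 3) X →
      e.IsStronglyAsymptoticallyFlatWith D 0 2 0 5 0 → e.IsSoleEnd →
      (∀ x : X, 0 ≤ D.metric.scalarCurvature x) →
      ∃ (φ : X → ℝ) (A : ℝ), ContMDiff (𝓡 3) 𝓘(ℝ) ∞ φ ∧ (∀ x, 0 < φ x) ∧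
        (∀ x, D.metric.dalembertian φ x = D.metric.scalarCurvature x * φ x / 8) ∧
        Integrable (fun x ↦ D.metric.scalarCurvature x * φ x) (riemannianMeasure D.h) ∧
        A = -(32 * Real.pi)⁻¹ *
          ∫ x, D.metric.scalarCurvature x * φ x ∂(riemannianMeasure D.h) ∧
        ∀ m : ℕ, m ≤ 2 →
          (fun x ↦ ‖iteratedFDeriv ℝ m (fun y ↦ endValue e φ y - (1 + A / ‖y‖)) x‖)
            =O[cobounded E3] fun x ↦ ‖x‖ ^ (-2 - m : ℝ)) :
    exists_conformal_negativeMass_of_massZero := by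
  intro X _ _ _ _ _ _ D _ e hor haf hsole hR0 hne
  letI : MeasurableSpace X := borel X
  haveI : BorelSpace X := ⟨rfl⟩
  haveI : LocallyCompactSpace X := Manifold.locallyCompact_of_finiteDimensional (I := 𝓡 3)
  obtain ⟨φ, A, hφs, hpos, hpde, hint, hA, hexp⟩ := hφ X D e hor haf hsole hR0
  exact exists_conformal_negativeMass_of_conformalFactor D e haf hφs hpos hpde
    (conformalFactor_coeff_neg D hR0 hne hpos hint hA) hexp fun x ↦ hR X D φ hφs hpos x

/-- **Step 1 of the rigidity theorem from Thm. 1 and the remaining printed steps of Cor. 3.1,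
with the formula (3.16)**: `scalarFlat_of_massZero` from `schoenYau_mass_nonneg` (Thm. 1), the
conformal scalar-curvature formula (`hR`) and the elliptic core with `A = -(1/32π) ∫ R φ dV`
(`hφ`), via `scalarFlat_of_massZero_of_facts`. Schoen–Yau 1979, p. 72: "Theorem 1 and
Corollary 3.1 imply that an asymptotically flat metric satisfying the hypotheses `M = 0`, `R ≥ 0`
must have `R = 0` on `N`." [cite: SchoenYauPMT1979, Thm. 1 and Cor. 3.1 (p. 72)] -/
theorem scalarFlat_of_massZero_of_conformalFactor_integral (h₀ : schoenYau_mass_nonneg)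
    (hR : ∀ (X : Type) [TopologicalSpace X] [ChartedSpace E3 X] [IsManifold (𝓡 3) ∞ X]
      (D : InitialDataSet (𝓡 3) X) [D.metric.HasLeviCivita] (φ : X → ℝ)
      (hφ : ContMDiff (𝓡 3) 𝓘(ℝ) ∞ φ) (hpos : ∀ x, 0 < φ x)
      [(D.conformal φ hφ hpos).metric.HasLeviCivita] (x : X),
      (D.conformal φ hφ hpos).metric.scalarCurvature x =
        (φ x)⁻¹ ^ 5 * (D.metric.scalarCurvature x * φ x - 8 * D.metric.dalembertian φ x))
    (hφ : ∀ (X : Type) [TopologicalSpace X] [ChartedSpace E3 X] [IsManifold (𝓡 3) ∞ X]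
      [T2Space X] [SecondCountableTopology X] [LocallyCompactSpace X] [ConnectedSpace X]
      [MeasurableSpace X] [BorelSpace X]
      (D : InitialDataSet (𝓡 3) X) [D.metric.HasLeviCivita] (e : AFEnd X),
      Literature.Topology.FourManifolds.IsOrientable (𝓡 3) X →
      e.IsStronglyAsymptoticallyFlatWith D 0 2 0 5 0 → e.IsSoleEnd →
      (∀ x : X, 0 ≤ D.metric.scalarCurvature x) →
      ∃ (φ : X → ℝ) (A : ℝ), ContMDiff (𝓡 3) 𝓘(ℝ) ∞ φ ∧ (∀ x, 0 < φ x) ∧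
        (∀ x, D.metric.dalembertian φ x = D.metric.scalarCurvature x * φ x / 8) ∧
        Integrable (fun x ↦ D.metric.scalarCurvature x * φ x) (riemannianMeasure D.h) ∧
        A = -(32 * Real.pi)⁻¹ *
          ∫ x, D.metric.scalarCurvature x * φ x ∂(riemannianMeasure D.h) ∧
        ∀ m : ℕ, m ≤ 2 →
          (fun x ↦ ‖iteratedFDeriv ℝ m (fun y ↦ endValue e φ y - (1 + A / ‖y‖)) x‖)
            =O[cobounded E3] fun x ↦ ‖x‖ ^ (-2 - m : ℝ)) :
    scalarFlat_of_massZero :=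
  scalarFlat_of_massZero_of_facts h₀
    (exists_conformal_negativeMass_of_massZero_of_conformalFactor_integral hR hφ)

/-! ### Cor. 3.1 from Lemma 3.3 as printed -/

/-- **Corollary 3.1 from Lemma 3.3** (Schoen–Yau, Comm. Math. Phys. 65 (1979), p. 72: "A special
case of Lemma 3.3 is the following corollary"). Hypothesis `h33`: the conclusion of Lemma 3.3
(pp. 71–72) in the case `R ≥ 0`, in which its smallness hypothesis
`(1/8) (∫_N R₋^{3/2})^{2/3} ≤ ε₀` is void — verbatim, *"there is a unique positive function `φ`
with `∂φ/∂n = 0` on `∂N` so that the metric `φ⁴ ds²` is asymptotically flat, scalar flat, and has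
total mass `-(1/16π) ∫_N R φ √g dx`"* — for data as in `exists_conformal_negativeMass_of_massZero`
(`X` oriented; `h - δ = o₅(r⁻²)` in the chart of `e`, i.e. (1.1)–(1.2) with `M = 0`; `e` the only
end; no boundary) with `R(h) ≥ 0`: there are `φ > 0` and data `D'` admitting the Levi-Civita API,
with metric `φ⁴ h`, scalar flat, such that `R φ` is `dV_h`-integrable and `e` is asymptotically
Schwarzschildean for `D'` ((1.1), two derivatives) with total mass `-(1/16π) ∫_X R φ dV_h`
(uniqueness and the equation `Δφ = Rφ/8` are not needed; scalar flatness being part of the printed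
conclusion, this form does not use the transformation law). Conclusion: the named fact
`exists_conformal_negativeMass_of_massZero` (Cor. 3.1) — the mass is negative when moreover
`R ≢ 0`, by `integral_scalarCurvature_mul_pos`. [cite: SchoenYauPMT1979, Cor. 3.1 (p. 72) and Lemma 3.3] -/
theorem exists_conformal_negativeMass_of_massZero_of_lemma33
    (h33 : ∀ (X : Type) [TopologicalSpace X] [ChartedSpace E3 X] [IsManifold (𝓡 3) ∞ X]
      [T2Space X] [SecondCountableTopology X] [LocallyCompactSpace X] [ConnectedSpace X]
      [MeasurableSpace X] [BorelSpace X]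
      (D : InitialDataSet (𝓡 3) X) [D.metric.HasLeviCivita] (e : AFEnd X),
      Literature.Topology.FourManifolds.IsOrientable (𝓡 3) X →
      e.IsStronglyAsymptoticallyFlatWith D 0 2 0 5 0 → e.IsSoleEnd →
      (∀ x : X, 0 ≤ D.metric.scalarCurvature x) →
      ∃ (φ : X → ℝ) (D' : InitialDataSet (𝓡 3) X) (_ : D'.metric.HasLeviCivita),
        (∀ x : X, 0 < φ x) ∧
        (∀ (x : X) (v w : TangentSpace (𝓡 3) x),
          D'.metric.val x v w = φ x ^ 4 * D.metric.val x v w) ∧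
        (∀ x : X, D'.metric.scalarCurvature x = 0) ∧
        Integrable (fun x ↦ D.metric.scalarCurvature x * φ x) (riemannianMeasure D.h) ∧
        IsAsymptoticallySchwarzschild e D'
          (-(16 * Real.pi)⁻¹ *
            ∫ x, D.metric.scalarCurvature x * φ x ∂(riemannianMeasure D.h)) 2) :
    exists_conformal_negativeMass_of_massZero := by
  intro X _ _ _ _ _ _ D _ e hor haf hsole hR hne
  letI : MeasurableSpace X := borel X
  haveI : BorelSpace X := ⟨rfl⟩
  haveI : LocallyCompactSpace X := Manifold.locallyCompact_of_finiteDimensional (I := 𝓡 3)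
  obtain ⟨φ, D', hL', hφ, hconf, hR', hint, hAS⟩ := h33 X D e hor haf hsole hR
  refine ⟨φ, D', hL', _, hφ, hconf, hAS, ?_, hR'⟩
  have hI := integral_scalarCurvature_mul_pos D hR hne hφ hint
  have h16 : 0 < (16 * Real.pi)⁻¹ := by positivity
  nlinarith

/-! ### Cor. 3.1 from the elliptic core alone -/

/-- **The conformal scalar-curvature formula in the shape of the hypothesis `hR`** of
`exists_conformal_negativeMass_of_massZero_of_conformalFactor` (`ConformalScalarFlat.lean`) and
`exists_conformal_negativeMass_of_massZero_of_conformalFactor_integral`: for the conformal data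
`D.conformal φ = (φ⁴ h, k)` of `PositiveMassConformal.lean`,
`R(φ⁴ h) = φ⁻⁵ (R(h) φ − 8 Δ_h φ)` at every point — Schoen–Yau 1979, §2 Step 1, p. 49 ("The
well-known formula for the scalar curvature `R̃` is `R̃ = φ⁻⁵(-8Δφ + Rφ)`"), now the theorem
`conformal_scalarCurvature_law` (`ConformalChange.lean`), applied to the Riemannian metric `D.h`
(`InitialDataSet.isRiemannian_metric`) and `φ⁴ h` (`InitialDataSet.metric_conformal_val`).
[cite: SchoenYauPMT1979, §2 Step 1 (p. 49)] -/
theorem InitialDataSet.scalarCurvature_conformal (X : Type) [TopologicalSpace X]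
    [ChartedSpace E3 X] [IsManifold (𝓡 3) ∞ X] (D : InitialDataSet (𝓡 3) X)
    [D.metric.HasLeviCivita] (φ : X → ℝ) (hφ : ContMDiff (𝓡 3) 𝓘(ℝ) ∞ φ) (hpos : ∀ x, 0 < φ x)
    [(D.conformal φ hφ hpos).metric.HasLeviCivita] (x : X) :
    (D.conformal φ hφ hpos).metric.scalarCurvature x =
      (φ x)⁻¹ ^ 5 * (D.metric.scalarCurvature x * φ x - 8 * D.metric.dalembertian φ x) := by
  rw [inv_pow]
  exact conformal_scalarCurvature_law X D.metric (D.conformal φ hφ hpos).metric φ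
    D.isRiemannian_metric hφ hpos (D.metric_conformal_val φ hφ hpos) x

/-- **Cor. 3.1 from the elliptic core alone.** The named fact
`exists_conformal_negativeMass_of_massZero` (Schoen–Yau, Comm. Math. Phys. 65 (1979), Cor. 3.1,
p. 72) follows from the elliptic core of Lemmas 3.2–3.3 by itself (`hφ`, for all admissible
`(X, h, e)` with `R ≥ 0` — `X` oriented, `h - δ = o₅(r⁻²)` in the chart of `e`, one end —: a
smooth `φ > 0` with `Δ_h φ = R φ / 8` ((3.22)), `R φ` integrable,
`A = -(1/32π) ∫_X R φ dV_h` ((3.16) for (3.23)) and `φ = 1 + A/r + O₂(r⁻²)` in the chart of `e`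
((3.17)–(3.18), (3.20))), the conformal scalar-curvature formula of p. 49 that
`exists_conformal_negativeMass_of_massZero_of_conformalFactor_integral` also consumed being the
theorem `InitialDataSet.scalarCurvature_conformal`. What remains hypothetical is thus exactly the
linear elliptic theory of §3 (Lemmas 3.1–3.2 and the solution of (3.22)).
[cite: SchoenYauPMT1979, Cor. 3.1 (p. 72) with Lemma 3.2 (3.16) and Lemma 3.3] -/
theorem exists_conformal_negativeMass_of_massZero_of_ellipticCore
    (hφ : ∀ (X : Type) [TopologicalSpace X] [ChartedSpace E3 X] [IsManifold (𝓡 3) ∞ X]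
      [T2Space X] [SecondCountableTopology X] [LocallyCompactSpace X] [ConnectedSpace X]
      [MeasurableSpace X] [BorelSpace X]
      (D : InitialDataSet (𝓡 3) X) [D.metric.HasLeviCivita] (e : AFEnd X),
      Literature.Topology.FourManifolds.IsOrientable (𝓡 3) X →
      e.IsStronglyAsymptoticallyFlatWith D 0 2 0 5 0 → e.IsSoleEnd →
      (∀ x : X, 0 ≤ D.metric.scalarCurvature x) →
      ∃ (φ : X → ℝ) (A : ℝ), ContMDiff (𝓡 3) 𝓘(ℝ) ∞ φ ∧ (∀ x, 0 < φ x) ∧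
        (∀ x, D.metric.dalembertian φ x = D.metric.scalarCurvature x * φ x / 8) ∧
        Integrable (fun x ↦ D.metric.scalarCurvature x * φ x) (riemannianMeasure D.h) ∧
        A = -(32 * Real.pi)⁻¹ *
          ∫ x, D.metric.scalarCurvature x * φ x ∂(riemannianMeasure D.h) ∧
        ∀ m : ℕ, m ≤ 2 →
          (fun x ↦ ‖iteratedFDeriv ℝ m (fun y ↦ endValue e φ y - (1 + A / ‖y‖)) x‖)
            =O[cobounded E3] fun x ↦ ‖x‖ ^ (-2 - m : ℝ)) :
    exists_conformal_negativeMass_of_massZero :=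
  exists_conformal_negativeMass_of_massZero_of_conformalFactor_integral
    (fun X _ _ _ D _ φ hφ hpos _ x ↦ InitialDataSet.scalarCurvature_conformal X D φ hφ hpos x) hφ

/-- **Step 1 of the rigidity theorem from Thm. 1 and the elliptic core**: `scalarFlat_of_massZero`
(Schoen–Yau 1979, p. 72: "Theorem 1 and Corollary 3.1 imply that an asymptotically flat metric
satisfying the hypotheses `M = 0`, `R ≥ 0` must have `R = 0` on `N`") from
`schoenYau_mass_nonneg` (Thm. 1) and the elliptic core of Lemmas 3.2–3.3 with the formula (3.16)
(`hφ`), via `scalarFlat_of_massZero_of_facts` and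
`exists_conformal_negativeMass_of_massZero_of_ellipticCore`.
[cite: SchoenYauPMT1979, Thm. 1 and Cor. 3.1 (p. 72)] -/
theorem scalarFlat_of_massZero_of_ellipticCore (h₀ : schoenYau_mass_nonneg)
    (hφ : ∀ (X : Type) [TopologicalSpace X] [ChartedSpace E3 X] [IsManifold (𝓡 3) ∞ X]
      [T2Space X] [SecondCountableTopology X] [LocallyCompactSpace X] [ConnectedSpace X]
      [MeasurableSpace X] [BorelSpace X]
      (D : InitialDataSet (𝓡 3) X) [D.metric.HasLeviCivita] (e : AFEnd X),
      Literature.Topology.FourManifolds.IsOrientable (𝓡 3) X →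
      e.IsStronglyAsymptoticallyFlatWith D 0 2 0 5 0 → e.IsSoleEnd →
      (∀ x : X, 0 ≤ D.metric.scalarCurvature x) →
      ∃ (φ : X → ℝ) (A : ℝ), ContMDiff (𝓡 3) 𝓘(ℝ) ∞ φ ∧ (∀ x, 0 < φ x) ∧
        (∀ x, D.metric.dalembertian φ x = D.metric.scalarCurvature x * φ x / 8) ∧
        Integrable (fun x ↦ D.metric.scalarCurvature x * φ x) (riemannianMeasure D.h) ∧
        A = -(32 * Real.pi)⁻¹ *
          ∫ x, D.metric.scalarCurvature x * φ x ∂(riemannianMeasure D.h) ∧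
        ∀ m : ℕ, m ≤ 2 →
          (fun x ↦ ‖iteratedFDeriv ℝ m (fun y ↦ endValue e φ y - (1 + A / ‖y‖)) x‖)
            =O[cobounded E3] fun x ↦ ‖x‖ ^ (-2 - m : ℝ)) :
    scalarFlat_of_massZero :=
  scalarFlat_of_massZero_of_facts h₀ (exists_conformal_negativeMass_of_massZero_of_ellipticCore hφ)

end Literature.Geometry.Lorentzian

end
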